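import Mathlib
import HarnessLib
import Summits.ValiantsHypothesis.ValiantsHypothesis.Theses.MonotoneRestoration
import Literature.Computability.AlgebraicComplexity.ArithCircuit
import Literature.Computability.AlgebraicComplexity.ArithCircuitProofs
import Literature.Computability.AlgebraicComplexity.MonotoneStructure
import Literature.Computability.AlgebraicComplexity.PermanentIrreducible
import Literature.ModelTheory.FiniteModelTheory.CkEquiv
import Summits.ValiantsHypothesis.ValiantsHypothesis.Theorems.MonotoneRestorationMonotoneRestorationQPCosetCount
import Summits.ValiantsHypothesis.ValiantsHypothesis.Theorems.MonotoneRestorationMonotoneRestorationQPSymmetricLB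
import Summits.ValiantsHypothesis.ValiantsHypothesis.Theorems.MonotoneRestorationMonotoneRestorationQPSupportSymmetrisation
import Summits.ValiantsHypothesis.ValiantsHypothesis.Theorems.MonotoneRestorationMonotoneRestorationQPSparseRegime
import Summits.ValiantsHypothesis.ValiantsHypothesis.Theorems.MonotoneRestorationMonotoneRestorationQPBeta
import Literature.Computability.AlgebraicComplexity.SymmetricArithCircuit
import Literature.Computability.AlgebraicComplexity.DawarWilsenach2025Proofs
import Literature.GroupTheory.PermutationGroups.SmallIndexSubgroups
import Summits.ValiantsHypothesis.ValiantsHypothesis.Theorems.MonotoneRestorationQP.Negative.LoadBearing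
import Summits.ValiantsHypothesis.ValiantsHypothesis.Theorems.MonotoneRestorationMonotoneRestorationQPPermSupportCount

/-! TTRL-lite variant V19130 of stmt-ValiantsHypothesis-15886 -/

set_option linter.dupNamespace false

namespace Summit.ValiantsHypothesis.ValiantsHypothesis.Theorems

open Summit.ValiantsHypothesis.ValiantsHypothesis.Theses.MonotoneRestoration
open Literature.Computability.AlgebraicComplexity

/-- TTRL-lite variant V19130 of `stub_esymmRowSums_structure` (stmt-ValiantsHypothesis-15886):
row-degree bounds add under multiplication — if every monomial of `f` has row degrees bounded by
`a` and every monomial of `g` has row degrees bounded by `b`, then every monomial of `f * g` has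
row degrees bounded by `a + b`. Immediate from `MvPolynomial.support_mul` (a monomial of the
product is a sum `m₁ + m₂` of monomials of the factors) and additivity of `rowDegrees`; no
positivity of the coefficient semiring is used. [folklore] -/
theorem stub_esymmRowSums_structure_var19130 :
    ∀ (n : ℕ) (f g : MvPolynomial (Fin n × Fin n) NNReal) (a b : Fin n → ℕ),
      (∀ m ∈ f.support, ∀ i : Fin n, rowDegrees m i ≤ a i) →
      (∀ m ∈ g.support, ∀ i : Fin n, rowDegrees m i ≤ b i) →
      ∀ m ∈ (f * g).support, ∀ i : Fin n, rowDegrees m i ≤ a i + b i := by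
  classical
  intro n f g a b hf hg m hm i
  obtain ⟨m₁, hm₁, m₂, hm₂, rfl⟩ := Finset.mem_add.1 (MvPolynomial.support_mul f g hm)
  rw [rowDegrees_add, Finsupp.add_apply]
  exact add_le_add (hf m₁ hm₁ i) (hg m₂ hm₂ i)

end Summit.ValiantsHypothesis.ValiantsHypothesis.Theorems
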